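/-
Copyright (c) 2026 the pub-hodgecm-mathlib formalisation cell (harness21).  Prover seat hodgecm-mathlib-K2Liu-p14 (g2), Track B «K2-LIT»,
#184♮ = hLiu418 = `stmt-HodgeConjecture-24832`; #42S organ S2, S2-asm FILE 2′ (LEAD F0P6-plan (g14) BATCH #24, M-158g (γ): the (Z-stab) half of the (slot) binder of
★ K2Liu-p11 (g2) `K2LiuSlotwiseSubmoduleInduction.mixed_prod_mem` AT THE PLACE `w`; interface words K2Liu-p11 (g2) 13:46:30Z (i)–(iii) + the partial evaluation (iv) below).
-/
import Summits.HodgeConjecture.HodgeConjecture.Theorems.K2LiuArchSWOnePlaceRegion               -- ★ FILE 2: `op_mem_of_real` pattern, `cayley_re/im_mem_lie`, `re_add_I_mul_im_*`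
import HarnessLib

/-!
# Crux `HLiu418`, organ S2, S2-asm FILE 2′: SLOT STABILITY OF THE MULTI-PLACE COMPACT PICTURE — the place-`w` Weil operators `P_{ab}, M_{ab}, L_{ab}, R_{ab}` of the multi-place
# carrier `R` preserve `Z = cp(SW-image)` (the other places frozen), i.e. the `(∀ v ∈ Z, D v ∈ Z)` half of the (slot) binder of ★ `K2LiuSlotwiseSubmoduleInduction`

Cell `hodgecm-mathlib`, crux item hLiu418 = `stmt-HodgeConjecture-24832`; squad K2 ∕ K2Liu; prover K2Liu-p14 (g2).  THEOREMS ONLY (no `def`, no instance, no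
notation, no named-fact hypothesis, no `sorry`); lane `--supports stmt-HodgeConjecture-24832 --as helper`.

INTERFACE (abstract, K2Liu-p11 (g2) 13:46:30Z «GO ABSTRACT»; his DEFS leaf `K2LiuU22MultiPlaceCarrierDefs` instantiates): one commutative ℂ-algebra `R` with the place-`w` data
`(dw, uw, Dinvw)` of ★ DEFS's generic operators; (iv) PARTIAL EVALUATION at the frozen places `πw v′ : R →ₐ[ℂ] Carrier` («keep place `w` symbolic, evaluate the others at `v′`»)
INTERTWINING the place-`w` operators of `R` with ★ DEFS's one-place operators (`hπp hπm hπl hπr` — `aeval`-naturality at the instance); the SW side as a family of ONE-PLACE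
sections `A Φ v′ : U(J) → ℂ` («`g ↦ archSW_c(Φ)(ι_w g · ∏_{w′≠w} ι_{w′} k_{v′_{w′}})`», FILE 3's letters) indexed by Fock-finite multi-place data `Φ : 𝔉` and frozen points `v′`,
with (law) each `A Φ v′ ∈ I_w(s, χ_k)` (★ 2c-inst place law through ★ `exists_tubeFrame_arch`) and (der, UNIFORM in `v′, u`) `∃ Φ′, ∀ v′ u, d∕dt|₀ A Φ v′ (k_u·exp tX) = A Φ′ v′ (k_u)`
(★ (r-b)-uniform p860738 through (J2⊗-arch)); `Z := {r | ∃ Φ, ∀ v′ u, A Φ v′ (k_u) = ev_u (πw v′ r)}` (given by its membership `iff`).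
* §1 `op_re_add_I_smul_im_ring` — ★ FILE 2's σ14 decomposition for the GENERIC operators of any ℂ-algebra;
* §3 (E1, K2Liu-ref1 13:55:00Z pin) **`opV_mem_of_real`, `opV_mem`, `pOpV_mem`, `mOpV_mem`, `rOpV_mem`, `lOpV_mem`** — the same with the frozen-data type an
  ABSTRACT `𝔙` (FILE 3 takes `𝔙 :=` unitary tuples, where `πM ι w v` and the frozen sections are honest);
* §2 **`opR_mem_of_real`** (★ FILE 1 `hasDerivAt_section_kU_exp_evalAt′` on `P := πw v′ r` + (der) + `HasDerivAt.unique` + the intertwinings), **`opR_mem`** (complex blocks),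
  **`pOpR_mem`, `mOpR_mem`, `lOpR_mem`, `rOpR_mem`** — `Z` is stable under the four families of place-`w` operators: the (Z-stab) half of (slot); the frozen-factor half is ★
  `K2LiuU22OperatorsFrozenFactor.slot_law_pOp∕mOp∕lOp_rOp` (p11), the anchors∕(gen) are ★ FILE 2 ∕ ★ S2-C per place.
References: [LeeZhu1998, §5 p. 5032]; [Knapp1986, Ch. VIII §3]; [Howe1989, §3]; [GanQiuTakeda2014, §5.6].
HONEST LABEL.  Count-neutral helper: `HC_CM` is proved only modulo the 7 printed citations (2 remaining named inputs: hLiu418 = `stmt-HodgeConjecture-24832`,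
h413 = `stmt-HodgeConjecture-24833`) until rung 0 closes.
-/

set_option autoImplicit false
set_option linter.dupNamespace false -- the mandated namespace repeats `HodgeConjecture.HodgeConjecture`

noncomputable section

open scoped ComplexConjugate
open Complex Matrix NormedSpace
open Summit.HodgeConjecture.HodgeConjecture.Cruxes.HLiu418.K2LiuHermitianTubeCocycle
open Summit.HodgeConjecture.HodgeConjecture.Cruxes.HLiu418.K2LiuArchInducedTubeDefs
open Summit.HodgeConjecture.HodgeConjecture.Cruxes.HLiu418.K2LiuU22CompactPictureDefs
open Summit.HodgeConjecture.HodgeConjecture.Cruxes.HLiu418.K2LiuU22CompactPictureOperatorDictionary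
open Summit.HodgeConjecture.HodgeConjecture.Cruxes.HLiu418.K2LiuArchSWOnePlaceRegion

namespace Summit.HodgeConjecture.HodgeConjecture.Cruxes.HLiu418.K2LiuArchSWImageSlotStability

/-! ## §1 σ14 for the generic operators of a ℂ-algebra -/

/-- **`Op_M F = Op_{M₁} F + i·Op_{M₂} F`** for the generic operators `pOp∕mOp∕lOp∕rOp d u Dinv` of ANY commutative ℂ-algebra (★ FILE 2 `op_re_add_I_smul_im` verbatim, ring-generic).
[cite: Knapp1986, Ch. VIII §3] -/
theorem op_re_add_I_smul_im_ring {R : Type*} [CommRing R] [Algebra ℂ R] (dw : Fin 2 → Fin 2 → Derivation ℂ R R) (uw : Matrix (Fin 2) (Fin 2) R) (Dinvw : R)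
    (k : ℤ) (s : ℂ) (α β γ δ : Matrix (Fin 2) (Fin 2) ℂ) (r : R) :
    (∑ a' : Fin 2, ∑ b' : Fin 2, β a' b' • pOp dw uw Dinvw (s + 1 + (-(k : ℂ)) / 2) a' b' r +
          ∑ a' : Fin 2, ∑ b' : Fin 2, γ a' b' • mOp dw uw (s + 1 - (-(k : ℂ)) / 2) a' b' r + ((-(k : ℂ)) * (α).trace) • r -
          ∑ a' : Fin 2, ∑ b' : Fin 2, α a' b' • lOp dw uw a' b' r + ∑ a' : Fin 2, ∑ b' : Fin 2, δ a' b' • rOp dw uw a' b' r) =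
      (∑ a' : Fin 2, ∑ b' : Fin 2, ((2 : ℂ)⁻¹ • (β + γᴴ)) a' b' • pOp dw uw Dinvw (s + 1 + (-(k : ℂ)) / 2) a' b' r +
          ∑ a' : Fin 2, ∑ b' : Fin 2, ((2 : ℂ)⁻¹ • (γ + βᴴ)) a' b' • mOp dw uw (s + 1 - (-(k : ℂ)) / 2) a' b' r + ((-(k : ℂ)) * (((2 : ℂ)⁻¹ • (α - αᴴ))).trace) • r -
          ∑ a' : Fin 2, ∑ b' : Fin 2, ((2 : ℂ)⁻¹ • (α - αᴴ)) a' b' • lOp dw uw a' b' r + ∑ a' : Fin 2, ∑ b' : Fin 2, ((2 : ℂ)⁻¹ • (δ - δᴴ)) a' b' • rOp dw uw a' b' r) +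
      I • (∑ a' : Fin 2, ∑ b' : Fin 2, ((2 * I : ℂ)⁻¹ • (β - γᴴ)) a' b' • pOp dw uw Dinvw (s + 1 + (-(k : ℂ)) / 2) a' b' r +
          ∑ a' : Fin 2, ∑ b' : Fin 2, ((2 * I : ℂ)⁻¹ • (γ - βᴴ)) a' b' • mOp dw uw (s + 1 - (-(k : ℂ)) / 2) a' b' r + ((-(k : ℂ)) * (((2 * I : ℂ)⁻¹ • (α + αᴴ))).trace) • r -
          ∑ a' : Fin 2, ∑ b' : Fin 2, ((2 * I : ℂ)⁻¹ • (α + αᴴ)) a' b' • lOp dw uw a' b' r + ∑ a' : Fin 2, ∑ b' : Fin 2, ((2 * I : ℂ)⁻¹ • (δ + δᴴ)) a' b' • rOp dw uw a' b' r) := by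
  have hI : I * (2 * I : ℂ)⁻¹ = (2 : ℂ)⁻¹ := by
    rw [mul_inv, ← mul_assoc, mul_comm I (2 : ℂ)⁻¹, mul_assoc, mul_inv_cancel₀ I_ne_zero, mul_one]
  have hI2 : ∀ x : ℂ, I * x * (2 * I : ℂ)⁻¹ = (2 : ℂ)⁻¹ * x := fun x => by rw [mul_right_comm, hI]
  simp only [Matrix.smul_apply, Matrix.add_apply, Matrix.sub_apply, smul_eq_mul, Fin.sum_univ_two, trace_smul, trace_add, trace_sub,
    smul_add, smul_sub, smul_smul, mul_add, mul_sub, ← mul_assoc, hI, hI2]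
  module

/-! ## §2 The place-`w` operators preserve the multi-place compact picture `Z` -/

section Slot

variable {ι : Type*} {R : Type*} [CommRing R] [Algebra ℂ R] (dw : Fin 2 → Fin 2 → Derivation ℂ R R) (uw : Matrix (Fin 2) (Fin 2) R) (Dinvw : R)
  (k : ℤ) (s : ℂ) {𝔉 : Type*}
  (A : 𝔉 → (ι → Matrix (Fin 2) (Fin 2) ℂ) → (Matrix (Fin 2 ⊕ Fin 2) (Fin 2 ⊕ Fin 2) ℂ → ℂ))
    (hlaw : ∀ Φ v', IsArchSiegelSection (fun z : ℂ => (conj z / ((‖z‖ : ℝ) : ℂ)) ^ k) s (A Φ v'))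
    (hder : ∀ (Φ : 𝔉) (α β γ δ : Matrix (Fin 2) (Fin 2) ℂ), (fromBlocks 1 1 (I • 1) (-(I • 1)) * fromBlocks α β γ δ * ((2 : ℂ)⁻¹ • fromBlocks 1 (-(I • 1)) 1 (I • 1)) : Matrix (Fin 2 ⊕ Fin 2) (Fin 2 ⊕ Fin 2) ℂ)ᴴ * Matrix.J (Fin 2) ℂ + Matrix.J (Fin 2) ℂ * (fromBlocks 1 1 (I • 1) (-(I • 1)) * fromBlocks α β γ δ * ((2 : ℂ)⁻¹ • fromBlocks 1 (-(I • 1)) 1 (I • 1)) : Matrix (Fin 2 ⊕ Fin 2) (Fin 2 ⊕ Fin 2) ℂ) = 0 →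
      ∃ Φ' : 𝔉, ∀ (v' : (ι → Matrix (Fin 2) (Fin 2) ℂ)) (u : Matrix (Fin 2) (Fin 2) ℂ), uᴴ * u = 1 →
        HasDerivAt (fun t : ℝ => A Φ v' (((2 : ℂ)⁻¹ • fromBlocks (1 + u) (-(I • (1 - u))) (I • (1 - u)) (1 + u) : Matrix (Fin 2 ⊕ Fin 2) (Fin 2 ⊕ Fin 2) ℂ) * NormedSpace.exp (t • (fromBlocks 1 1 (I • 1) (-(I • 1)) * fromBlocks α β γ δ * ((2 : ℂ)⁻¹ • fromBlocks 1 (-(I • 1)) 1 (I • 1)) : Matrix (Fin 2 ⊕ Fin 2) (Fin 2 ⊕ Fin 2) ℂ)))) (A Φ' v' ((2 : ℂ)⁻¹ • fromBlocks (1 + u) (-(I • (1 - u))) (I • (1 - u)) (1 + u) : Matrix (Fin 2 ⊕ Fin 2) (Fin 2 ⊕ Fin 2) ℂ)) 0)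
    (πw : (ι → Matrix (Fin 2) (Fin 2) ℂ) → (R →ₐ[ℂ] Carrier))
    (hπp : ∀ (v' : (ι → Matrix (Fin 2) (Fin 2) ℂ)) (p : ℂ) (a b : Fin 2) (r : R), πw v' (pOp dw uw Dinvw p a b r) = pOp pd uMat dInv p a b (πw v' r))
    (hπm : ∀ (v' : (ι → Matrix (Fin 2) (Fin 2) ℂ)) (q : ℂ) (a b : Fin 2) (r : R), πw v' (mOp dw uw q a b r) = mOp pd uMat q a b (πw v' r))
    (hπl : ∀ (v' : (ι → Matrix (Fin 2) (Fin 2) ℂ)) (a b : Fin 2) (r : R), πw v' (lOp dw uw a b r) = lOp pd uMat a b (πw v' r))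
    (hπr : ∀ (v' : (ι → Matrix (Fin 2) (Fin 2) ℂ)) (a b : Fin 2) (r : R), πw v' (rOp dw uw a b r) = rOp pd uMat a b (πw v' r))
    (Z : Submodule ℂ R)
    (hZ : ∀ r : R, r ∈ Z ↔ ∃ Φ : 𝔉, ∀ (v' : (ι → Matrix (Fin 2) (Fin 2) ℂ)) (u : Matrix (Fin 2) (Fin 2) ℂ), uᴴ * u = 1 → ∀ hu : u.det ≠ 0,
      A Φ v' ((2 : ℂ)⁻¹ • fromBlocks (1 + u) (-(I • (1 - u))) (I • (1 - u)) (1 + u) : Matrix (Fin 2 ⊕ Fin 2) (Fin 2 ⊕ Fin 2) ℂ) = evalAt u hu (πw v' r))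

include hlaw hder hπp hπm hπl hπr hZ

/-- **`Z` IS STABLE UNDER `Op_X` (place `w`, REAL `X = C(α β;γ δ)C′ ∈ 𝔲(J)`)**: at frozen data `v′` the one-place section `A Φ v′` has compact picture `πw v′ r` (membership in `Z`), so ★ FILE 1
gives `d∕dt|₀ A Φ v′ (k_u exp tX) = ev_u (Op_X (πw v′ r)) = ev_u (πw v′ (Op_X r))` (intertwinings); (der) gives the same derivative as `A Φ′ v′ (k_u)` with ONE `Φ′` for all `v′, u`;
uniqueness of derivatives puts `Op_X r` in `Z`. [cite: Knapp1986, Ch. VIII §3] [cite: Howe1989, §3] -/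
theorem opR_mem_of_real (α β γ δ : Matrix (Fin 2) (Fin 2) ℂ) (hX : (fromBlocks 1 1 (I • 1) (-(I • 1)) * fromBlocks α β γ δ * ((2 : ℂ)⁻¹ • fromBlocks 1 (-(I • 1)) 1 (I • 1)) : Matrix (Fin 2 ⊕ Fin 2) (Fin 2 ⊕ Fin 2) ℂ)ᴴ * Matrix.J (Fin 2) ℂ + Matrix.J (Fin 2) ℂ * (fromBlocks 1 1 (I • 1) (-(I • 1)) * fromBlocks α β γ δ * ((2 : ℂ)⁻¹ • fromBlocks 1 (-(I • 1)) 1 (I • 1)) : Matrix (Fin 2 ⊕ Fin 2) (Fin 2 ⊕ Fin 2) ℂ) = 0) {r : R} (hr : r ∈ Z) :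
    (∑ a' : Fin 2, ∑ b' : Fin 2, β a' b' • pOp dw uw Dinvw (s + 1 + (-(k : ℂ)) / 2) a' b' r +
          ∑ a' : Fin 2, ∑ b' : Fin 2, γ a' b' • mOp dw uw (s + 1 - (-(k : ℂ)) / 2) a' b' r + ((-(k : ℂ)) * (α).trace) • r -
          ∑ a' : Fin 2, ∑ b' : Fin 2, α a' b' • lOp dw uw a' b' r + ∑ a' : Fin 2, ∑ b' : Fin 2, δ a' b' • rOp dw uw a' b' r) ∈ Z := by
  obtain ⟨Φ, hΦ⟩ := (hZ r).1 hr
  obtain ⟨Φ', hΦ'⟩ := hder Φ α β γ δ hX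
  refine (hZ _).2 ⟨Φ', fun v' u hu hu' => ?_⟩
  have h1 := hΦ' v' u hu
  have h2 := hasDerivAt_section_kU_exp_evalAt' k s (hlaw Φ v') (πw v' r) (fun v hv hv' => hΦ v' v hv hv') hu hu' α β γ δ hX
  have h12 := h1.unique h2
  rw [h12]
  simp only [map_add, map_sub, map_sum, map_smul, hπp, hπm, hπl, hπr]

/-- **… AND UNDER `Op_M` FOR EVERY COMPLEX BLOCK QUADRUPLE** (σ14). [cite: Knapp1986, Ch. VIII §3] -/
theorem opR_mem (α β γ δ : Matrix (Fin 2) (Fin 2) ℂ) {r : R} (hr : r ∈ Z) :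
    (∑ a' : Fin 2, ∑ b' : Fin 2, β a' b' • pOp dw uw Dinvw (s + 1 + (-(k : ℂ)) / 2) a' b' r +
          ∑ a' : Fin 2, ∑ b' : Fin 2, γ a' b' • mOp dw uw (s + 1 - (-(k : ℂ)) / 2) a' b' r + ((-(k : ℂ)) * (α).trace) • r -
          ∑ a' : Fin 2, ∑ b' : Fin 2, α a' b' • lOp dw uw a' b' r + ∑ a' : Fin 2, ∑ b' : Fin 2, δ a' b' • rOp dw uw a' b' r) ∈ Z := by
  rw [op_re_add_I_smul_im_ring]
  exact Z.add_mem (opR_mem_of_real dw uw Dinvw k s A hlaw hder πw hπp hπm hπl hπr Z hZ _ _ _ _ (cayley_re_mem_lie α β γ δ) hr)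
    (Z.smul_mem I (opR_mem_of_real dw uw Dinvw k s A hlaw hder πw hπp hπm hπl hπr Z hZ _ _ _ _ (cayley_im_mem_lie α β γ δ) hr))

/-- **(Z-stab) for `P_{ab}` at place `w`.** [cite: LeeZhu1998, p. 5032] -/
theorem pOpR_mem (a b : Fin 2) {r : R} (hr : r ∈ Z) : pOp dw uw Dinvw (s + 1 + (-(k : ℂ)) / 2) a b r ∈ Z := by
  have h := opR_mem dw uw Dinvw k s A hlaw hder πw hπp hπm hπl hπr Z hZ 0 (Matrix.single a b (1 : ℂ)) 0 0 hr
  fin_cases a <;> fin_cases b <;>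
    simpa [Matrix.single_apply, Fin.sum_univ_two, Matrix.zero_apply, Matrix.trace_zero] using h

/-- **(Z-stab) for `M_{ab}` at place `w`.** [cite: LeeZhu1998, p. 5032] -/
theorem mOpR_mem (a b : Fin 2) {r : R} (hr : r ∈ Z) : mOp dw uw (s + 1 - (-(k : ℂ)) / 2) a b r ∈ Z := by
  have h := opR_mem dw uw Dinvw k s A hlaw hder πw hπp hπm hπl hπr Z hZ 0 0 (Matrix.single a b (1 : ℂ)) 0 hr
  fin_cases a <;> fin_cases b <;>
    simpa [Matrix.single_apply, Fin.sum_univ_two, Matrix.zero_apply, Matrix.trace_zero] using h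

/-- **(Z-stab) for `R_{ab}` at place `w`.** [cite: KashiwaraVergne1978, §II.5] -/
theorem rOpR_mem (a b : Fin 2) {r : R} (hr : r ∈ Z) : rOp dw uw a b r ∈ Z := by
  have h := opR_mem dw uw Dinvw k s A hlaw hder πw hπp hπm hπl hπr Z hZ 0 0 0 (Matrix.single a b (1 : ℂ)) hr
  fin_cases a <;> fin_cases b <;>
    simpa [Matrix.single_apply, Fin.sum_univ_two, Matrix.zero_apply, Matrix.trace_zero] using h

/-- **(Z-stab) for `L_{ab}` at place `w`.** [cite: KashiwaraVergne1978, §II.5] -/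
theorem lOpR_mem (a b : Fin 2) {r : R} (hr : r ∈ Z) : lOp dw uw a b r ∈ Z := by
  have h := opR_mem dw uw Dinvw k s A hlaw hder πw hπp hπm hπl hπr Z hZ (Matrix.single a b (1 : ℂ)) 0 0 0 hr
  have h' : ((-(k : ℂ)) * (Matrix.single a b (1 : ℂ)).trace) • r - lOp dw uw a b r ∈ Z := by
    fin_cases a <;> fin_cases b <;>
      simpa [Matrix.single_apply, Fin.sum_univ_two, Matrix.zero_apply, Matrix.trace_fin_two] using h
  have h'' := Z.sub_mem (Z.smul_mem ((-(k : ℂ)) * (Matrix.single a b (1 : ℂ)).trace) hr) h'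
  rwa [sub_sub_cancel] at h''

end Slot

/-! ## §3 (E1) The same over an ABSTRACT frozen-data type `𝔙` (the form FILE 3 instantiates: `𝔙 := {v : ι → U(2)}`, K2Liu-ref1 13:55:00Z) -/

section SlotAbstractFrozen

variable {𝔙 : Type*} {R : Type*} [CommRing R] [Algebra ℂ R] (dw : Fin 2 → Fin 2 → Derivation ℂ R R) (uw : Matrix (Fin 2) (Fin 2) R) (Dinvw : R)
  (k : ℤ) (s : ℂ) {𝔉 : Type*}
  (A : 𝔉 → 𝔙 → (Matrix (Fin 2 ⊕ Fin 2) (Fin 2 ⊕ Fin 2) ℂ → ℂ))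
    (hlaw : ∀ Φ v', IsArchSiegelSection (fun z : ℂ => (conj z / ((‖z‖ : ℝ) : ℂ)) ^ k) s (A Φ v'))
    (hder : ∀ (Φ : 𝔉) (α β γ δ : Matrix (Fin 2) (Fin 2) ℂ), (fromBlocks 1 1 (I • 1) (-(I • 1)) * fromBlocks α β γ δ * ((2 : ℂ)⁻¹ • fromBlocks 1 (-(I • 1)) 1 (I • 1)) : Matrix (Fin 2 ⊕ Fin 2) (Fin 2 ⊕ Fin 2) ℂ)ᴴ * Matrix.J (Fin 2) ℂ + Matrix.J (Fin 2) ℂ * (fromBlocks 1 1 (I • 1) (-(I • 1)) * fromBlocks α β γ δ * ((2 : ℂ)⁻¹ • fromBlocks 1 (-(I • 1)) 1 (I • 1)) : Matrix (Fin 2 ⊕ Fin 2) (Fin 2 ⊕ Fin 2) ℂ) = 0 →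
      ∃ Φ' : 𝔉, ∀ (v' : 𝔙) (u : Matrix (Fin 2) (Fin 2) ℂ), uᴴ * u = 1 →
        HasDerivAt (fun t : ℝ => A Φ v' (((2 : ℂ)⁻¹ • fromBlocks (1 + u) (-(I • (1 - u))) (I • (1 - u)) (1 + u) : Matrix (Fin 2 ⊕ Fin 2) (Fin 2 ⊕ Fin 2) ℂ) * NormedSpace.exp (t • (fromBlocks 1 1 (I • 1) (-(I • 1)) * fromBlocks α β γ δ * ((2 : ℂ)⁻¹ • fromBlocks 1 (-(I • 1)) 1 (I • 1)) : Matrix (Fin 2 ⊕ Fin 2) (Fin 2 ⊕ Fin 2) ℂ)))) (A Φ' v' ((2 : ℂ)⁻¹ • fromBlocks (1 + u) (-(I • (1 - u))) (I • (1 - u)) (1 + u) : Matrix (Fin 2 ⊕ Fin 2) (Fin 2 ⊕ Fin 2) ℂ)) 0)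
    (πw : 𝔙 → (R →ₐ[ℂ] Carrier))
    (hπp : ∀ (v' : 𝔙) (p : ℂ) (a b : Fin 2) (r : R), πw v' (pOp dw uw Dinvw p a b r) = pOp pd uMat dInv p a b (πw v' r))
    (hπm : ∀ (v' : 𝔙) (q : ℂ) (a b : Fin 2) (r : R), πw v' (mOp dw uw q a b r) = mOp pd uMat q a b (πw v' r))
    (hπl : ∀ (v' : 𝔙) (a b : Fin 2) (r : R), πw v' (lOp dw uw a b r) = lOp pd uMat a b (πw v' r))
    (hπr : ∀ (v' : 𝔙) (a b : Fin 2) (r : R), πw v' (rOp dw uw a b r) = rOp pd uMat a b (πw v' r))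
    (Z : Submodule ℂ R)
    (hZ : ∀ r : R, r ∈ Z ↔ ∃ Φ : 𝔉, ∀ (v' : 𝔙) (u : Matrix (Fin 2) (Fin 2) ℂ), uᴴ * u = 1 → ∀ hu : u.det ≠ 0,
      A Φ v' ((2 : ℂ)⁻¹ • fromBlocks (1 + u) (-(I • (1 - u))) (I • (1 - u)) (1 + u) : Matrix (Fin 2 ⊕ Fin 2) (Fin 2 ⊕ Fin 2) ℂ) = evalAt u hu (πw v' r))

include hlaw hder hπp hπm hπl hπr hZ

/-- **(E1) ABSTRACT FROZEN TYPE `𝔙`** (K2Liu-ref1 (g5) 13:55:00Z instance pin: at the instance `𝔙 :=` the UNITARY frozen tuples, where `πM` and the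
frozen sections are honest).  **`Z` IS STABLE UNDER `Op_X` (place `w`, REAL `X`)**: at frozen data `v′` the one-place section `A Φ v′` has compact picture `πw v′ r` (membership in `Z`), so ★ FILE 1
gives `d∕dt|₀ A Φ v′ (k_u exp tX) = ev_u (Op_X (πw v′ r)) = ev_u (πw v′ (Op_X r))` (intertwinings); (der) gives the same derivative as `A Φ′ v′ (k_u)` with ONE `Φ′` for all `v′, u`;
uniqueness of derivatives puts `Op_X r` in `Z`. [cite: Knapp1986, Ch. VIII §3] [cite: Howe1989, §3] -/
theorem opV_mem_of_real (α β γ δ : Matrix (Fin 2) (Fin 2) ℂ) (hX : (fromBlocks 1 1 (I • 1) (-(I • 1)) * fromBlocks α β γ δ * ((2 : ℂ)⁻¹ • fromBlocks 1 (-(I • 1)) 1 (I • 1)) : Matrix (Fin 2 ⊕ Fin 2) (Fin 2 ⊕ Fin 2) ℂ)ᴴ * Matrix.J (Fin 2) ℂ + Matrix.J (Fin 2) ℂ * (fromBlocks 1 1 (I • 1) (-(I • 1)) * fromBlocks α β γ δ * ((2 : ℂ)⁻¹ • fromBlocks 1 (-(I • 1)) 1 (I • 1)) : Matrix (Fin 2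 ⊕ Fin 2) (Fin 2 ⊕ Fin 2) ℂ) = 0) {r : R} (hr : r ∈ Z) :
    (∑ a' : Fin 2, ∑ b' : Fin 2, β a' b' • pOp dw uw Dinvw (s + 1 + (-(k : ℂ)) / 2) a' b' r +
          ∑ a' : Fin 2, ∑ b' : Fin 2, γ a' b' • mOp dw uw (s + 1 - (-(k : ℂ)) / 2) a' b' r + ((-(k : ℂ)) * (α).trace) • r -
          ∑ a' : Fin 2, ∑ b' : Fin 2, α a' b' • lOp dw uw a' b' r + ∑ a' : Fin 2, ∑ b' : Fin 2, δ a' b' • rOp dw uw a' b' r) ∈ Z := by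
  obtain ⟨Φ, hΦ⟩ := (hZ r).1 hr
  obtain ⟨Φ', hΦ'⟩ := hder Φ α β γ δ hX
  refine (hZ _).2 ⟨Φ', fun v' u hu hu' => ?_⟩
  have h1 := hΦ' v' u hu
  have h2 := hasDerivAt_section_kU_exp_evalAt' k s (hlaw Φ v') (πw v' r) (fun v hv hv' => hΦ v' v hv hv') hu hu' α β γ δ hX
  have h12 := h1.unique h2
  rw [h12]
  simp only [map_add, map_sub, map_sum, map_smul, hπp, hπm, hπl, hπr]

/-- **… AND UNDER `Op_M` FOR EVERY COMPLEX BLOCK QUADRUPLE** (σ14). [cite: Knapp1986, Ch. VIII §3] -/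
theorem opV_mem (α β γ δ : Matrix (Fin 2) (Fin 2) ℂ) {r : R} (hr : r ∈ Z) :
    (∑ a' : Fin 2, ∑ b' : Fin 2, β a' b' • pOp dw uw Dinvw (s + 1 + (-(k : ℂ)) / 2) a' b' r +
          ∑ a' : Fin 2, ∑ b' : Fin 2, γ a' b' • mOp dw uw (s + 1 - (-(k : ℂ)) / 2) a' b' r + ((-(k : ℂ)) * (α).trace) • r -
          ∑ a' : Fin 2, ∑ b' : Fin 2, α a' b' • lOp dw uw a' b' r + ∑ a' : Fin 2, ∑ b' : Fin 2, δ a' b' • rOp dw uw a' b' r) ∈ Z := by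
  rw [op_re_add_I_smul_im_ring]
  exact Z.add_mem (opV_mem_of_real dw uw Dinvw k s A hlaw hder πw hπp hπm hπl hπr Z hZ _ _ _ _ (cayley_re_mem_lie α β γ δ) hr)
    (Z.smul_mem I (opV_mem_of_real dw uw Dinvw k s A hlaw hder πw hπp hπm hπl hπr Z hZ _ _ _ _ (cayley_im_mem_lie α β γ δ) hr))

/-- **(Z-stab) for `P_{ab}` at place `w`.** [cite: LeeZhu1998, p. 5032] -/
theorem pOpV_mem (a b : Fin 2) {r : R} (hr : r ∈ Z) : pOp dw uw Dinvw (s + 1 + (-(k : ℂ)) / 2) a b r ∈ Z := by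
  have h := opV_mem dw uw Dinvw k s A hlaw hder πw hπp hπm hπl hπr Z hZ 0 (Matrix.single a b (1 : ℂ)) 0 0 hr
  fin_cases a <;> fin_cases b <;>
    simpa [Matrix.single_apply, Fin.sum_univ_two, Matrix.zero_apply, Matrix.trace_zero] using h

/-- **(Z-stab) for `M_{ab}` at place `w`.** [cite: LeeZhu1998, p. 5032] -/
theorem mOpV_mem (a b : Fin 2) {r : R} (hr : r ∈ Z) : mOp dw uw (s + 1 - (-(k : ℂ)) / 2) a b r ∈ Z := by
  have h := opV_mem dw uw Dinvw k s A hlaw hder πw hπp hπm hπl hπr Z hZ 0 0 (Matrix.single a b (1 : ℂ)) 0 hr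
  fin_cases a <;> fin_cases b <;>
    simpa [Matrix.single_apply, Fin.sum_univ_two, Matrix.zero_apply, Matrix.trace_zero] using h

/-- **(Z-stab) for `R_{ab}` at place `w`.** [cite: KashiwaraVergne1978, §II.5] -/
theorem rOpV_mem (a b : Fin 2) {r : R} (hr : r ∈ Z) : rOp dw uw a b r ∈ Z := by
  have h := opV_mem dw uw Dinvw k s A hlaw hder πw hπp hπm hπl hπr Z hZ 0 0 0 (Matrix.single a b (1 : ℂ)) hr
  fin_cases a <;> fin_cases b <;>
    simpa [Matrix.single_apply, Fin.sum_univ_two, Matrix.zero_apply, Matrix.trace_zero] using h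

/-- **(Z-stab) for `L_{ab}` at place `w`.** [cite: KashiwaraVergne1978, §II.5] -/
theorem lOpV_mem (a b : Fin 2) {r : R} (hr : r ∈ Z) : lOp dw uw a b r ∈ Z := by
  have h := opV_mem dw uw Dinvw k s A hlaw hder πw hπp hπm hπl hπr Z hZ (Matrix.single a b (1 : ℂ)) 0 0 0 hr
  have h' : ((-(k : ℂ)) * (Matrix.single a b (1 : ℂ)).trace) • r - lOp dw uw a b r ∈ Z := by
    fin_cases a <;> fin_cases b <;>
      simpa [Matrix.single_apply, Fin.sum_univ_two, Matrix.zero_apply, Matrix.trace_fin_two] using h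
  have h'' := Z.sub_mem (Z.smul_mem ((-(k : ℂ)) * (Matrix.single a b (1 : ℂ)).trace) hr) h'
  rwa [sub_sub_cancel] at h''

end SlotAbstractFrozen

end Summit.HodgeConjecture.HodgeConjecture.Cruxes.HLiu418.K2LiuArchSWImageSlotStability

end
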